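import Summits.AtomisticToContinuum.HydrodynamicLimit.Theorems.CorrectorPressureDecay.Negative.Frame
import Summits.AtomisticToContinuum.HydrodynamicLimit.Theorems.CellForecastPressureDecay.Negative.PerParticle

/-!
# Negative knowledge for `CorrectorPressureDecay` (stmt-AtomisticToContinuum-14135), III: statics — `W = 0` fails

From the standing disprover's `Cruxes/CorrectorPressureDecay/Disproof.lean` §(c.1)
(refuter-cdisprove-stmt-AtomisticToContinuum-14135-0). The refutation of the no-corrector specialisation of the crux
`AntiMazurCoboundaries.CorrectorPressureDecay`:

* `StaticPressureDecay` / `CorrectorPressureDecayZeroCorrector` — the crux with the corrector frozen at `W = 0`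
  (flow-free resp. verbatim form; the latter implies the crux with `lag = τ₀ = 1`, the cost integral being
  `G_N(univ) = 1 ≤ e^{δ(N+1)}`) — are FALSE: by the product formula of `Negative/Frame.lean` the static moment is
  EXACTLY `(E_γ e^{2φ̄ g})^{N+1}`, i.e. pressure `(N+1) log E e^{2g} > 0` at every `N` for the admissible witness
  `g = gW κ = κ sin v₀ sin v₁` of the sibling crux's `CellForecastPressureDecay/Negative/PerParticle.lean`
  (`gW_orthogonal`, `one_lt_integral_exp_gW`; reused, not re-declared), with `δ = ½ log E e^{2g}`
  (`staticPressureDecay_false`, `correctorPressureDecay_false_zeroCorrector`). The corrector is load-bearing.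
-/

noncomputable section

open MeasureTheory ProbabilityTheory Set Filter Topology
open scoped ENNReal

namespace Summit.AtomisticToContinuum.HydrodynamicLimit.Theorems.CorrectorPressureDecayNegative.Statics

open Literature.MathematicalPhysics.KineticTheory (T3 V3 hsDiameter localGibbsLaw localGibbsMeasure
  localGibbsProfile)
open Literature.Analysis.FluidPDE (HardSphereFlow Config configEnergy)
open Summit.AtomisticToContinuum.HydrodynamicLimit.Theorems.CellForecastPressureDecay (gW continuous_gW abs_gW_le
  abs_gW_le_abs gW_orthogonal one_lt_integral_exp_gW)

section ZeroCorrector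

open Literature.MathematicalPhysics.KineticTheory

/-- `e^{c·gW κ}` is integrable under the standard Gaussian (bounded continuous). [folklore] -/
theorem integrable_exp_mul_gW (c κ : ℝ) : Integrable (fun v => Real.exp (c * gW κ v)) (stdGaussian V3) := by
  refine (integrable_const (Real.exp (|c| * |κ|))).mono' (by
    have := continuous_gW κ
    fun_prop : Continuous fun v => Real.exp (c * gW κ v)).aestronglyMeasurable (ae_of_all _ fun v => ?_)
  rw [Real.norm_eq_abs, abs_of_pos (Real.exp_pos _), Real.exp_le_exp]
  calc c * gW κ v ≤ |c * gW κ v| := le_abs_self _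
    _ = |c| * |gW κ v| := abs_mul _ _
    _ ≤ |c| * |κ| := mul_le_mul_of_nonneg_left (abs_gW_le_abs κ v) (abs_nonneg c)

/-- **The `W = 0` specialisation of the crux, flow-free.** Verbatim the crux with the corrector witness frozen
at `W = 0` (so `D_W = 0`, the cost clause is trivially true and dropped, and `τ₀`, `lag`, `Φ` disappear); the
Gibbs law is written as the tree's flow-free `localGibbsMeasure` (`= localGibbsLaw … Φ` for EVERY `Φ`,
`localGibbsLaw_eq`). A variant statement refuted below, not a fact. -/
def StaticPressureDecay : Prop :=
  ∀ (a θ : ℝ) (u₀ : V3), 0 < a → 0 < θ → ∃ σ₀ : ℝ, 0 < σ₀ ∧ ∀ σ : ℝ, 0 < σ → σ < σ₀ →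
    ∃ κ : ℝ, 0 < κ ∧ ∀ (φ : T3 → ℝ) (g : V3 → ℝ), Continuous φ → Continuous g → (∀ x, |φ x| ≤ 1) →
      (∀ v, |g v| ≤ κ) →
      (∀ (c₀ c₂ : ℝ) (b : V3), ∫ v, g v * (c₀ + inner ℝ b v + c₂ * ‖v‖ ^ 2) ∂stdGaussian V3 = 0) →
      ∀ δ : ℝ, 0 < δ → ∃ N₀ : ℕ, ∀ N : ℕ, N₀ ≤ N →
        ∫⁻ z, ENNReal.ofReal (Real.exp (2 * ∑ i, φ (z i).1 * g ((Real.sqrt θ)⁻¹ • ((z i).2 - u₀))))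
          ∂(localGibbsMeasure σ (fun _ => a) (fun _ => u₀) (fun _ => θ) N) ≤
          ENNReal.ofReal (Real.exp (δ * (N + 1)))

/-- **`W = 0` FAILS** (the corrector is load-bearing): witness `a = θ = 1`, `u₀ = 0`, `φ ≡ 1`, `g = gW κ` (the
prover's own `κ`), `δ = ½ log E_γ e^{2g} > 0`; the static moment is EXACTLY `(E_γ e^{2g})^{N+1} = e^{2δ(N+1)} >
e^{δ(N+1)}` for every `N` (product formula `lintegral_exp_sum_vel_localGibbsMeasure`). [folklore] -/
theorem staticPressureDecay_false : ¬ StaticPressureDecay := by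
  intro h
  obtain ⟨σ₀, hσ₀, hσ⟩ := h 1 1 0 one_pos one_pos
  set σ : ℝ := min (σ₀ / 2) 4⁻¹ with hσdef
  have hσpos : 0 < σ := lt_min (by linarith) (by norm_num)
  have hσlt : σ < σ₀ := (min_le_left _ _).trans_lt (by linarith)
  have hσ2 : σ ≤ 1 / 2 := (min_le_right _ _).trans (by norm_num)
  obtain ⟨κ, hκ, hmain⟩ := hσ σ hσpos hσlt
  set M : ℝ := ∫ v, Real.exp (2 * gW κ v) ∂stdGaussian V3 with hM
  have hM1 : 1 < M := one_lt_integral_exp_gW hκ.ne'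
  set δ : ℝ := Real.log M / 2 with hδ
  have hlogpos : 0 < Real.log M := Real.log_pos hM1
  have hδpos : 0 < δ := by positivity
  obtain ⟨N₀, hN⟩ := hmain (fun _ => 1) (gW κ) continuous_const (continuous_gW κ) (fun _ => by simp)
    (abs_gW_le hκ.le) (gW_orthogonal κ) δ hδpos
  have hb := hN N₀ le_rfl
  have hrw : ∀ z : Config (N₀ + 1) (Fin 3) T3, Real.exp (2 * ∑ i, (fun _ : T3 => (1 : ℝ)) (z i).1 *
      gW κ ((Real.sqrt 1)⁻¹ • ((z i).2 - 0))) = Real.exp (∑ i, 2 * gW κ (z i).2) := by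
    intro z
    congr 1
    rw [Finset.mul_sum]
    refine Finset.sum_congr rfl fun i _ => ?_
    simp
  simp_rw [hrw] at hb
  rw [lintegral_exp_sum_vel_localGibbsMeasure one_pos one_pos 0 hσ2 N₀
    ((continuous_gW κ).measurable.const_mul 2), gaussMeasure_zero_one,
    ← ofReal_integral_eq_lintegral_ofReal (integrable_exp_mul_gW 2 κ)
      (ae_of_all _ fun _ => (Real.exp_pos _).le)] at hb
  have hfl : Real.exp (2 * δ) ≤ ∫ w, Real.exp (2 * gW κ w) ∂stdGaussian V3 := by
    rw [show 2 * δ = Real.log M by rw [hδ]; ring, Real.exp_log (by linarith)]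
  have hpow : ENNReal.ofReal (Real.exp (2 * δ)) ^ (N₀ + 1) ≤ ENNReal.ofReal (Real.exp (δ * (N₀ + 1))) :=
    (pow_le_pow_left₀ (by positivity) (ENNReal.ofReal_le_ofReal hfl) _).trans hb
  rw [← ENNReal.ofReal_pow (Real.exp_pos _).le, ← Real.exp_nat_mul,
    ENNReal.ofReal_le_ofReal_iff (Real.exp_pos _).le, Real.exp_le_exp] at hpow
  push_cast at hpow
  nlinarith

/-- **The `W = 0` specialisation of the crux, verbatim** (flows kept: the defect clause at `W = 0`, i.e. with
`lag⁻¹ (0 − 0)` deleted). It implies the crux (take `W = 0`, `lag = τ₀ = 1`), and it is FALSE. A variant statement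
refuted below, not a fact. -/
def CorrectorPressureDecayZeroCorrector : Prop :=
  ∀ (a θ : ℝ) (u₀ : V3), 0 < a → 0 < θ → ∃ σ₀ : ℝ, 0 < σ₀ ∧ ∀ σ : ℝ, 0 < σ → σ < σ₀ →
    (∀ (N : ℕ) (Φ : HardSphereFlow (Literature.Analysis.FluidPDE.Torus.geometry (Fin 3)) (hsDiameter σ N) (N + 1)),
      IsProbabilityMeasure (localGibbsLaw σ (fun _ => a) (fun _ => u₀) (fun _ => θ) N Φ)) ∧
    ∃ κ : ℝ, 0 < κ ∧ ∀ (φ : T3 → ℝ) (g : V3 → ℝ), Continuous φ → Continuous g → (∀ x, |φ x| ≤ 1) →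
      (∀ v, |g v| ≤ κ) →
      (∀ (c₀ c₂ : ℝ) (b : V3), ∫ v, g v * (c₀ + inner ℝ b v + c₂ * ‖v‖ ^ 2) ∂stdGaussian V3 = 0) →
      ∀ δ : ℝ, 0 < δ → ∃ N₀ : ℕ, ∀ N : ℕ, N₀ ≤ N →
        ∀ Φ : HardSphereFlow (Literature.Analysis.FluidPDE.Torus.geometry (Fin 3)) (hsDiameter σ N) (N + 1),
        ∫⁻ z, ENNReal.ofReal (Real.exp (2 * ∑ i, φ (z i).1 * g ((Real.sqrt θ)⁻¹ • ((z i).2 - u₀))))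
          ∂(localGibbsLaw σ (fun _ => a) (fun _ => u₀) (fun _ => θ) N Φ) ≤
          ENNReal.ofReal (Real.exp (δ * (N + 1)))

/-- The flow-carrying `W = 0` specialisation implies the flow-free one (flows exist, `nonempty_flow`, and the
law does not depend on the flow, `localGibbsLaw_eq`). [folklore] -/
theorem staticPressureDecay_of_zeroCorrector (h : CorrectorPressureDecayZeroCorrector) :
    StaticPressureDecay := by
  intro a θ u₀ ha hθ
  obtain ⟨σ₀, hσ₀, hσ⟩ := h a θ u₀ ha hθ
  refine ⟨min σ₀ 2⁻¹, lt_min hσ₀ (by norm_num), fun σ hs hs' => ?_⟩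
  obtain ⟨_, κ, hκ, hmain⟩ := hσ σ hs (hs'.trans_le (min_le_left _ _))
  refine ⟨κ, hκ, fun φ g hφ hg hφ1 hgκ horth δ hδ => ?_⟩
  obtain ⟨N₀, hN⟩ := hmain φ g hφ hg hφ1 hgκ horth δ hδ
  refine ⟨N₀, fun N hNN => ?_⟩
  obtain ⟨Φ⟩ := nonempty_flow hs (hs'.trans_le (min_le_right _ _)) N
  rw [← localGibbsLaw_eq σ _ _ _ N Φ]
  exact hN N hNN Φ

/-- **(c.1) `W = 0` fails, verbatim form**: any proof of the crux must use a non-trivial corrector. [folklore] -/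
theorem correctorPressureDecay_false_zeroCorrector : ¬ CorrectorPressureDecayZeroCorrector :=
  fun h => staticPressureDecay_false (staticPressureDecay_of_zeroCorrector h)

end ZeroCorrector

end Summit.AtomisticToContinuum.HydrodynamicLimit.Theorems.CorrectorPressureDecayNegative.Statics
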